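import Mathlib.Data.Real.Basic
import Mathlib.Tactic.Linarith
import Mathlib.Tactic.Positivity
import HarnessLib

/-!
# QUANT lane R8, T-DEC: the polynomial certificate of LEMMA W's LIGHT / TOP-UNREACHABLE two-row cell (h a mid, both rows light into h, the
# bottom copy of `l` incompatible with its top copy: `2l + r + k ≤ T`) — the (★7′) inequality cleared of denominators, replayed from an exact Handelman
# certificate (arm-1 gen 61, architect)

builds on p205010 (kernel theorem, internal audit signed; external expert review pending)

Support file (`--supports stmt-CriticalPhenomena-4575`), QUANT lane seat prim-quant-arm-1 (gen 61, architect); memo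
`run/shared/lean/prim/quant/prim-quant-arm-1-g61/ARCH-G61.md` §1–§2.  Pure real algebra; standard axioms, no sorries, no definitions.  Used by
`…QuantGluedWindowLightInc` (`lightInc_star`, `gluedPullback_windowPair_twoRow_lightInc`).  The inequality: on the box `0 ≤ y ≤ t₂ ≤ 1`, `t₁ ≥ 0`,
`t₁ + t₂ ≤ 1`, `1 ≤ c ≤ 1 + y`, `0 ≤ 2ε ≤ 1 + y − c`,
`c(c + (1−y)ε) ≥ (c + t₁ε + t₂(1+y−c))·(t₀(c+(1−y)ε) + t₁(1−ε)c + t₂(1−y)c(c+(1−y)ε))`, `t₀ = 1 − t₁ − t₂` — the cleared form of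
(★7′) `t₀/c + t₁(1−ε)/(c+(1−y)ε) + t₂(1−y) ≤ 1/(c + t₁ε + t₂(1+y−c))`, arm-1 g60's (★7) with the larger denominator `c + t₁ε + t₂(1+y−c)` on the right
(`t₂(1+y−c)` in place of `t₂(1+y−c−ε)`): this is what the bound `A ≤ m = t₁r + t₂(r+k)` gives when only `r + k ≤ T − 2l` (not `2r + k`) is known, i.e. it
serves every configuration in which the bottom copy of `l` cannot use the top copy, whatever the middle copy does.  Certificate: kit j305169 (typer g23's
Handelman pipeline; 177 products of ≤ 7 of the ten box generators, exact rational weights, identity verified exactly); `linarith only` replays it.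

HONEST STATUS.  `GluedLemmaW` (flow form), `GluedDominatedMass`, the band, `SiblingStep`, `FarTreeRow` OPEN; RATE class (log\*) / honest sentence of
`run/shared/lean/prim/quant/README.md` unchanged.  [this work].  Nothing here is cited as a published result.
-/

namespace Summit.CriticalPhenomena.PercolationContinuityZ3.Theorems
namespace Quant
namespace LawDec

set_option maxRecDepth 200000 in
/-- **THE LIGHT / TOP-UNREACHABLE CELL POLYNOMIAL** ((★7′) cleared of denominators): `c(c+(1−y)ε) − D′·B ≥ 0` on the cell's box, `D′ = c + t₁ε + t₂(1+y−c)`,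
`B = t₀(c+(1−y)ε) + t₁(1−ε)c + t₂(1−y)c(c+(1−y)ε)`; replayed from an exact 177-term Handelman certificate (kit j305169: products of ≤ 7 of the ten box
generators, rational weights; identity verified exactly). [this work] -/
theorem lightInc_poly (y t1 t2 c e : ℝ) (h0 : 0 ≤ y) (h1 : 0 ≤ t2 - y) (h2 : 0 ≤ t1) (h3 : 0 ≤ 1 - t1 - t2) (h4 : 0 ≤ c - 1) (h5 : 0 ≤ 1 + y - c) (h6 : 0 ≤ e) (h7 : 0 ≤ 1 + y - c - 2 * e) (h8 : 0 ≤ 1 - y) (h9 : 0 ≤ 1 - t2) :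
    0 ≤ c * (c + (1 - y) * e) - (c + t1 * e + t2 * (1 + y - c)) * ((1 - t1 - t2) * (c + (1 - y) * e) + t1 * (1 - e) * c + (1 - y) * t2 * c * (c + (1 - y) * e)) := by
  linarith only [mul_nonneg (mul_nonneg (mul_nonneg (h0) h0) h0) h0,
    mul_nonneg (mul_nonneg (mul_nonneg (mul_nonneg (h0) h0) h0) h0) h0,
    mul_nonneg (mul_nonneg (mul_nonneg (mul_nonneg (mul_nonneg (mul_nonneg (h0) h0) h0) h0) h0) h0) h0,
    mul_nonneg (mul_nonneg (mul_nonneg (mul_nonneg (mul_nonneg (mul_nonneg (h0) h0) h0) h0) h0) h0) h2,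
    mul_nonneg (mul_nonneg (mul_nonneg (mul_nonneg (mul_nonneg (mul_nonneg (h0) h0) h0) h0) h0) h1) h7,
    mul_nonneg (mul_nonneg (mul_nonneg (mul_nonneg (mul_nonneg (mul_nonneg (h0) h0) h0) h0) h0) h3) h6,
    mul_nonneg (mul_nonneg (mul_nonneg (mul_nonneg (mul_nonneg (mul_nonneg (h0) h0) h0) h0) h0) h4) h4,
    mul_nonneg (mul_nonneg (mul_nonneg (mul_nonneg (mul_nonneg (mul_nonneg (h0) h0) h0) h0) h0) h4) h7,
    mul_nonneg (mul_nonneg (mul_nonneg (mul_nonneg (mul_nonneg (mul_nonneg (h0) h0) h0) h0) h0) h5) h9,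
    mul_nonneg (mul_nonneg (mul_nonneg (mul_nonneg (mul_nonneg (h0) h0) h0) h0) h0) h7,
    mul_nonneg (mul_nonneg (mul_nonneg (mul_nonneg (h0) h0) h0) h0) h1,
    mul_nonneg (mul_nonneg (mul_nonneg (mul_nonneg (mul_nonneg (h0) h0) h0) h0) h1) h1,
    mul_nonneg (mul_nonneg (mul_nonneg (mul_nonneg (mul_nonneg (h0) h0) h0) h0) h1) h4,
    mul_nonneg (mul_nonneg (mul_nonneg (mul_nonneg (mul_nonneg (mul_nonneg (h0) h0) h0) h0) h1) h4) h4,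
    mul_nonneg (mul_nonneg (mul_nonneg (mul_nonneg (mul_nonneg (mul_nonneg (h0) h0) h0) h0) h1) h4) h7,
    mul_nonneg (mul_nonneg (mul_nonneg (mul_nonneg (mul_nonneg (mul_nonneg (h0) h0) h0) h0) h2) h3) h5,
    mul_nonneg (mul_nonneg (mul_nonneg (mul_nonneg (mul_nonneg (mul_nonneg (h0) h0) h0) h0) h2) h5) h7,
    mul_nonneg (mul_nonneg (mul_nonneg (mul_nonneg (mul_nonneg (mul_nonneg (h0) h0) h0) h0) h3) h3) h7,
    mul_nonneg (mul_nonneg (mul_nonneg (mul_nonneg (mul_nonneg (mul_nonneg (h0) h0) h0) h0) h3) h5) h5,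
    mul_nonneg (mul_nonneg (mul_nonneg (mul_nonneg (mul_nonneg (mul_nonneg (h0) h0) h0) h0) h3) h7) h9,
    mul_nonneg (mul_nonneg (mul_nonneg (mul_nonneg (h0) h0) h0) h0) h4,
    mul_nonneg (mul_nonneg (mul_nonneg (mul_nonneg (mul_nonneg (mul_nonneg (h0) h0) h0) h0) h4) h4) h4,
    mul_nonneg (mul_nonneg (mul_nonneg (mul_nonneg (mul_nonneg (h0) h0) h0) h0) h4) h7,
    mul_nonneg (mul_nonneg (mul_nonneg (mul_nonneg (mul_nonneg (h0) h0) h0) h0) h6) h9,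
    mul_nonneg (mul_nonneg (mul_nonneg (h0) h0) h0) h1,
    mul_nonneg (mul_nonneg (mul_nonneg (mul_nonneg (mul_nonneg (mul_nonneg (h0) h0) h0) h1) h3) h5) h6,
    mul_nonneg (mul_nonneg (mul_nonneg (mul_nonneg (h0) h0) h0) h1) h4,
    mul_nonneg (mul_nonneg (mul_nonneg (mul_nonneg (mul_nonneg (mul_nonneg (h0) h0) h0) h1) h5) h5) h9,
    mul_nonneg (mul_nonneg (mul_nonneg (mul_nonneg (mul_nonneg (h0) h0) h0) h2) h3) h5,
    mul_nonneg (mul_nonneg (mul_nonneg (mul_nonneg (mul_nonneg (mul_nonneg (h0) h0) h0) h2) h4) h4) h6,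
    mul_nonneg (mul_nonneg (mul_nonneg (mul_nonneg (mul_nonneg (mul_nonneg (h0) h0) h0) h2) h4) h5) h7,
    mul_nonneg (mul_nonneg (mul_nonneg (mul_nonneg (mul_nonneg (h0) h0) h0) h2) h4) h6,
    mul_nonneg (mul_nonneg (mul_nonneg (mul_nonneg (h0) h0) h0) h2) h5,
    mul_nonneg (mul_nonneg (mul_nonneg (mul_nonneg (mul_nonneg (mul_nonneg (h0) h0) h0) h2) h7) h7) h9,
    mul_nonneg (mul_nonneg (mul_nonneg (mul_nonneg (mul_nonneg (mul_nonneg (h0) h0) h0) h2) h7) h8) h9,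
    mul_nonneg (mul_nonneg (mul_nonneg (mul_nonneg (mul_nonneg (mul_nonneg (h0) h0) h0) h3) h3) h5) h7,
    mul_nonneg (mul_nonneg (mul_nonneg (mul_nonneg (mul_nonneg (h0) h0) h0) h3) h5) h5,
    mul_nonneg (mul_nonneg (mul_nonneg (mul_nonneg (mul_nonneg (h0) h0) h0) h3) h5) h6,
    mul_nonneg (mul_nonneg (mul_nonneg (mul_nonneg (mul_nonneg (mul_nonneg (h0) h0) h0) h3) h5) h7) h9,
    mul_nonneg (mul_nonneg (mul_nonneg (h0) h0) h0) h4,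
    mul_nonneg (mul_nonneg (mul_nonneg (mul_nonneg (h0) h0) h0) h4) h4,
    mul_nonneg (mul_nonneg (mul_nonneg (mul_nonneg (mul_nonneg (mul_nonneg (h0) h0) h0) h4) h5) h5) h9,
    mul_nonneg (mul_nonneg (mul_nonneg (h0) h0) h0) h6,
    mul_nonneg (mul_nonneg (mul_nonneg (mul_nonneg (h0) h0) h0) h6) h8,
    mul_nonneg (mul_nonneg (mul_nonneg (mul_nonneg (h0) h0) h1) h1) h5,
    mul_nonneg (mul_nonneg (mul_nonneg (mul_nonneg (h0) h0) h1) h1) h6,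
    mul_nonneg (mul_nonneg (mul_nonneg (mul_nonneg (mul_nonneg (mul_nonneg (h0) h0) h1) h1) h7) h8) h8,
    mul_nonneg (mul_nonneg (mul_nonneg (h0) h0) h1) h4,
    mul_nonneg (mul_nonneg (mul_nonneg (mul_nonneg (h0) h0) h1) h4) h4,
    mul_nonneg (mul_nonneg (mul_nonneg (h0) h0) h1) h6,
    mul_nonneg (mul_nonneg (mul_nonneg (mul_nonneg (mul_nonneg (mul_nonneg (h0) h0) h1) h7) h8) h8) h8,
    mul_nonneg (mul_nonneg (mul_nonneg (mul_nonneg (mul_nonneg (mul_nonneg (h0) h0) h2) h2) h4) h4) h7,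
    mul_nonneg (mul_nonneg (mul_nonneg (mul_nonneg (mul_nonneg (h0) h0) h2) h3) h7) h7,
    mul_nonneg (mul_nonneg (mul_nonneg (mul_nonneg (mul_nonneg (mul_nonneg (h0) h0) h2) h4) h7) h7) h8,
    mul_nonneg (mul_nonneg (mul_nonneg (mul_nonneg (mul_nonneg (h0) h0) h2) h4) h7) h9,
    mul_nonneg (mul_nonneg (mul_nonneg (h0) h0) h2) h6,
    mul_nonneg (mul_nonneg (mul_nonneg (mul_nonneg (h0) h0) h2) h7) h7,
    mul_nonneg (mul_nonneg (mul_nonneg (mul_nonneg (mul_nonneg (h0) h0) h3) h3) h5) h7,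
    mul_nonneg (mul_nonneg (mul_nonneg (mul_nonneg (mul_nonneg (mul_nonneg (h0) h0) h3) h4) h4) h4) h4,
    mul_nonneg (mul_nonneg (mul_nonneg (mul_nonneg (mul_nonneg (mul_nonneg (h0) h0) h3) h4) h5) h5) h5,
    mul_nonneg (mul_nonneg (mul_nonneg (mul_nonneg (mul_nonneg (mul_nonneg (h0) h0) h3) h4) h5) h8) h9,
    mul_nonneg (mul_nonneg (mul_nonneg (mul_nonneg (mul_nonneg (h0) h0) h3) h4) h5) h9,
    mul_nonneg (mul_nonneg (mul_nonneg (mul_nonneg (mul_nonneg (h0) h0) h3) h5) h7) h9,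
    mul_nonneg (mul_nonneg (h0) h0) h4,
    mul_nonneg (mul_nonneg (mul_nonneg (h0) h0) h4) h4,
    mul_nonneg (mul_nonneg (mul_nonneg (mul_nonneg (h0) h0) h4) h4) h4,
    mul_nonneg (mul_nonneg (mul_nonneg (mul_nonneg (mul_nonneg (mul_nonneg (h0) h0) h4) h5) h8) h9) h9,
    mul_nonneg (mul_nonneg (mul_nonneg (mul_nonneg (mul_nonneg (mul_nonneg (h0) h1) h1) h1) h4) h5) h5,
    mul_nonneg (mul_nonneg (mul_nonneg (mul_nonneg (mul_nonneg (mul_nonneg (h0) h1) h1) h4) h7) h8) h8,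
    mul_nonneg (mul_nonneg (mul_nonneg (mul_nonneg (mul_nonneg (mul_nonneg (h0) h1) h1) h4) h8) h8) h8,
    mul_nonneg (mul_nonneg (mul_nonneg (h0) h1) h1) h5,
    mul_nonneg (mul_nonneg (mul_nonneg (mul_nonneg (mul_nonneg (h0) h1) h1) h5) h5) h8,
    mul_nonneg (mul_nonneg (mul_nonneg (mul_nonneg (h0) h1) h1) h5) h6,
    mul_nonneg (mul_nonneg (mul_nonneg (mul_nonneg (h0) h1) h2) h5) h5,
    mul_nonneg (mul_nonneg (mul_nonneg (h0) h1) h2) h6,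
    mul_nonneg (mul_nonneg (mul_nonneg (mul_nonneg (mul_nonneg (h0) h1) h3) h5) h5) h5,
    mul_nonneg (mul_nonneg (mul_nonneg (mul_nonneg (mul_nonneg (h0) h1) h3) h5) h5) h6,
    mul_nonneg (mul_nonneg (h0) h1) h4,
    mul_nonneg (mul_nonneg (mul_nonneg (h0) h1) h4) h4,
    mul_nonneg (mul_nonneg (mul_nonneg (mul_nonneg (mul_nonneg (mul_nonneg (h0) h1) h4) h4) h4) h4) h9,
    mul_nonneg (mul_nonneg (mul_nonneg (mul_nonneg (mul_nonneg (mul_nonneg (h0) h1) h4) h5) h5) h5) h9,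
    mul_nonneg (mul_nonneg (mul_nonneg (mul_nonneg (mul_nonneg (mul_nonneg (h0) h1) h4) h5) h8) h8) h9,
    mul_nonneg (mul_nonneg (mul_nonneg (h0) h1) h4) h9,
    mul_nonneg (mul_nonneg (mul_nonneg (mul_nonneg (mul_nonneg (mul_nonneg (h0) h1) h5) h5) h5) h8) h8,
    mul_nonneg (mul_nonneg (mul_nonneg (mul_nonneg (mul_nonneg (h0) h1) h5) h5) h5) h9,
    mul_nonneg (mul_nonneg (mul_nonneg (mul_nonneg (mul_nonneg (h0) h2) h3) h5) h5) h5,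
    mul_nonneg (mul_nonneg (mul_nonneg (mul_nonneg (mul_nonneg (mul_nonneg (h0) h2) h3) h6) h8) h8) h8,
    mul_nonneg (mul_nonneg (mul_nonneg (mul_nonneg (mul_nonneg (h0) h2) h4) h4) h7) h9,
    mul_nonneg (mul_nonneg (mul_nonneg (mul_nonneg (h0) h2) h4) h7) h9,
    mul_nonneg (mul_nonneg (mul_nonneg (mul_nonneg (h0) h2) h5) h5) h7,
    mul_nonneg (mul_nonneg (mul_nonneg (mul_nonneg (mul_nonneg (mul_nonneg (h0) h2) h6) h7) h8) h8) h8,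
    mul_nonneg (mul_nonneg (mul_nonneg (mul_nonneg (mul_nonneg (mul_nonneg (h0) h3) h4) h4) h4) h5) h9,
    mul_nonneg (mul_nonneg (mul_nonneg (mul_nonneg (mul_nonneg (mul_nonneg (h0) h3) h4) h4) h4) h6) h8,
    mul_nonneg (mul_nonneg (mul_nonneg (mul_nonneg (mul_nonneg (h0) h3) h4) h4) h5) h9,
    mul_nonneg (mul_nonneg (mul_nonneg (mul_nonneg (h0) h3) h4) h5) h8,
    mul_nonneg (mul_nonneg (mul_nonneg (mul_nonneg (h0) h3) h4) h5) h9,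
    mul_nonneg (mul_nonneg (mul_nonneg (mul_nonneg (mul_nonneg (mul_nonneg (h0) h3) h4) h7) h8) h8) h9,
    mul_nonneg (mul_nonneg (mul_nonneg (mul_nonneg (mul_nonneg (mul_nonneg (h0) h3) h5) h5) h5) h5) h9,
    mul_nonneg (mul_nonneg (mul_nonneg (mul_nonneg (mul_nonneg (mul_nonneg (h0) h3) h5) h5) h5) h6) h8,
    mul_nonneg (mul_nonneg (mul_nonneg (mul_nonneg (mul_nonneg (mul_nonneg (h0) h4) h4) h4) h5) h9) h9,
    mul_nonneg (mul_nonneg (mul_nonneg (mul_nonneg (mul_nonneg (h0) h4) h4) h5) h9) h9,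
    mul_nonneg (mul_nonneg (mul_nonneg (mul_nonneg (mul_nonneg (mul_nonneg (h0) h4) h4) h7) h8) h8) h9,
    mul_nonneg (mul_nonneg (mul_nonneg (mul_nonneg (mul_nonneg (mul_nonneg (h0) h4) h5) h5) h9) h9) h9,
    mul_nonneg (mul_nonneg (h0) h4) h6,
    mul_nonneg (mul_nonneg (mul_nonneg (mul_nonneg (mul_nonneg (h0) h4) h7) h8) h8) h8,
    mul_nonneg (mul_nonneg (mul_nonneg (mul_nonneg (h0) h4) h7) h9) h9,
    mul_nonneg (mul_nonneg (mul_nonneg (mul_nonneg (mul_nonneg (mul_nonneg (h0) h5) h5) h5) h5) h9) h9,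
    mul_nonneg (mul_nonneg (mul_nonneg (mul_nonneg (mul_nonneg (mul_nonneg (h1) h1) h1) h4) h4) h4) h8,
    mul_nonneg (mul_nonneg (mul_nonneg (mul_nonneg (mul_nonneg (h1) h1) h1) h4) h5) h7,
    mul_nonneg (mul_nonneg (mul_nonneg (mul_nonneg (h1) h1) h5) h5) h6,
    mul_nonneg (mul_nonneg (mul_nonneg (mul_nonneg (mul_nonneg (h1) h2) h4) h4) h7) h8,
    mul_nonneg (mul_nonneg (mul_nonneg (mul_nonneg (h1) h2) h4) h5) h6,
    mul_nonneg (mul_nonneg (mul_nonneg (h1) h2) h5) h6,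
    mul_nonneg (mul_nonneg (mul_nonneg (mul_nonneg (h1) h2) h5) h7) h7,
    mul_nonneg (mul_nonneg (mul_nonneg (mul_nonneg (mul_nonneg (mul_nonneg (h1) h2) h5) h7) h7) h8) h8,
    mul_nonneg (mul_nonneg (h1) h2) h6,
    mul_nonneg (mul_nonneg (mul_nonneg (h1) h2) h6) h7,
    mul_nonneg (mul_nonneg (mul_nonneg (mul_nonneg (h1) h2) h6) h7) h8,
    mul_nonneg (mul_nonneg (mul_nonneg (mul_nonneg (mul_nonneg (mul_nonneg (h1) h3) h4) h4) h4) h5) h8,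
    mul_nonneg (mul_nonneg (mul_nonneg (mul_nonneg (h1) h3) h4) h4) h5,
    mul_nonneg (mul_nonneg (mul_nonneg (mul_nonneg (mul_nonneg (h1) h3) h4) h4) h5) h8,
    mul_nonneg (mul_nonneg (mul_nonneg (mul_nonneg (mul_nonneg (mul_nonneg (h1) h3) h5) h5) h5) h5) h8,
    mul_nonneg (mul_nonneg (mul_nonneg (mul_nonneg (mul_nonneg (h1) h3) h5) h5) h7) h8,
    mul_nonneg (mul_nonneg (mul_nonneg (mul_nonneg (mul_nonneg (mul_nonneg (h1) h3) h5) h5) h7) h8) h8,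
    mul_nonneg (mul_nonneg (mul_nonneg (h1) h4) h4) h4,
    mul_nonneg (mul_nonneg (mul_nonneg (mul_nonneg (h1) h4) h5) h8) h9,
    mul_nonneg (mul_nonneg (mul_nonneg (h1) h4) h5) h9,
    mul_nonneg (mul_nonneg (mul_nonneg (mul_nonneg (mul_nonneg (h1) h5) h5) h7) h8) h9,
    mul_nonneg (mul_nonneg (mul_nonneg (mul_nonneg (h1) h5) h5) h7) h9,
    mul_nonneg (mul_nonneg (mul_nonneg (mul_nonneg (h2) h2) h4) h7) h7,
    mul_nonneg (mul_nonneg (h2) h2) h6,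
    mul_nonneg (mul_nonneg (mul_nonneg (h2) h2) h6) h6,
    mul_nonneg (mul_nonneg (mul_nonneg (mul_nonneg (h2) h2) h6) h6) h8,
    mul_nonneg (mul_nonneg (mul_nonneg (mul_nonneg (mul_nonneg (h2) h2) h6) h6) h8) h8,
    mul_nonneg (mul_nonneg (mul_nonneg (mul_nonneg (h2) h3) h4) h5) h7,
    mul_nonneg (mul_nonneg (mul_nonneg (h2) h3) h4) h6,
    mul_nonneg (mul_nonneg (mul_nonneg (mul_nonneg (h2) h3) h4) h6) h7,
    mul_nonneg (mul_nonneg (mul_nonneg (mul_nonneg (h2) h3) h4) h6) h8,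
    mul_nonneg (mul_nonneg (mul_nonneg (h2) h3) h6) h7,
    mul_nonneg (mul_nonneg (mul_nonneg (mul_nonneg (h2) h3) h6) h7) h8,
    mul_nonneg (mul_nonneg (mul_nonneg (mul_nonneg (h2) h3) h6) h8) h8,
    mul_nonneg (mul_nonneg (mul_nonneg (mul_nonneg (mul_nonneg (h2) h3) h6) h8) h8) h8,
    mul_nonneg (mul_nonneg (mul_nonneg (mul_nonneg (mul_nonneg (h2) h4) h4) h4) h7) h8,
    mul_nonneg (mul_nonneg (mul_nonneg (mul_nonneg (mul_nonneg (mul_nonneg (h2) h4) h4) h5) h8) h8) h8,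
    mul_nonneg (mul_nonneg (mul_nonneg (mul_nonneg (h2) h4) h4) h7) h8,
    mul_nonneg (mul_nonneg (h2) h4) h6,
    mul_nonneg (mul_nonneg (mul_nonneg (mul_nonneg (mul_nonneg (h2) h4) h6) h7) h8) h8,
    mul_nonneg (mul_nonneg (mul_nonneg (mul_nonneg (mul_nonneg (h2) h4) h6) h8) h8) h8,
    mul_nonneg (mul_nonneg (mul_nonneg (mul_nonneg (mul_nonneg (h2) h4) h6) h8) h8) h9,
    mul_nonneg (mul_nonneg (mul_nonneg (mul_nonneg (h2) h4) h6) h8) h9,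
    mul_nonneg (mul_nonneg (mul_nonneg (mul_nonneg (mul_nonneg (mul_nonneg (h2) h4) h7) h7) h8) h8) h9,
    mul_nonneg (mul_nonneg (mul_nonneg (mul_nonneg (mul_nonneg (h2) h5) h5) h5) h7) h8,
    mul_nonneg (mul_nonneg (mul_nonneg (mul_nonneg (mul_nonneg (mul_nonneg (h2) h5) h6) h7) h8) h8) h9,
    mul_nonneg (h2) h6,
    mul_nonneg (mul_nonneg (h2) h6) h7,
    mul_nonneg (mul_nonneg (mul_nonneg (mul_nonneg (h2) h6) h8) h8) h9,
    mul_nonneg (mul_nonneg (mul_nonneg (mul_nonneg (mul_nonneg (mul_nonneg (h3) h3) h4) h4) h4) h7) h8,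
    mul_nonneg (mul_nonneg (mul_nonneg (mul_nonneg (h3) h3) h4) h5) h5,
    mul_nonneg (mul_nonneg (mul_nonneg (mul_nonneg (mul_nonneg (h3) h3) h4) h5) h5) h8,
    mul_nonneg (mul_nonneg (mul_nonneg (mul_nonneg (h3) h3) h4) h5) h6,
    mul_nonneg (mul_nonneg (mul_nonneg (mul_nonneg (mul_nonneg (h3) h3) h4) h5) h6) h8,
    mul_nonneg (mul_nonneg (mul_nonneg (mul_nonneg (mul_nonneg (mul_nonneg (h3) h3) h5) h5) h5) h7) h8,
    mul_nonneg (mul_nonneg (mul_nonneg (mul_nonneg (mul_nonneg (mul_nonneg (h3) h4) h4) h4) h7) h8) h9,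
    mul_nonneg (mul_nonneg (mul_nonneg (h3) h4) h4) h5,
    mul_nonneg (mul_nonneg (mul_nonneg (mul_nonneg (h3) h4) h5) h5) h9,
    mul_nonneg (mul_nonneg (mul_nonneg (mul_nonneg (mul_nonneg (mul_nonneg (h3) h5) h5) h5) h7) h8) h9,
    mul_nonneg (mul_nonneg (mul_nonneg (mul_nonneg (mul_nonneg (mul_nonneg (h4) h4) h4) h5) h5) h9) h9,
    mul_nonneg (mul_nonneg (mul_nonneg (mul_nonneg (mul_nonneg (mul_nonneg (h4) h4) h4) h8) h8) h9) h9,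
    mul_nonneg (mul_nonneg (mul_nonneg (mul_nonneg (mul_nonneg (mul_nonneg (h4) h4) h4) h8) h9) h9) h9,
    mul_nonneg (mul_nonneg (h4) h4) h5,
    mul_nonneg (mul_nonneg (mul_nonneg (mul_nonneg (h4) h4) h5) h8) h9,
    mul_nonneg (mul_nonneg (mul_nonneg (mul_nonneg (h4) h4) h7) h8) h8,
    mul_nonneg (mul_nonneg (mul_nonneg (mul_nonneg (mul_nonneg (h4) h4) h7) h8) h8) h8,
    mul_nonneg (mul_nonneg (mul_nonneg (mul_nonneg (mul_nonneg (mul_nonneg (h4) h5) h7) h8) h8) h9) h9,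
    mul_nonneg (mul_nonneg (mul_nonneg (mul_nonneg (h4) h5) h7) h9) h9,
    mul_nonneg (mul_nonneg (mul_nonneg (mul_nonneg (mul_nonneg (h4) h5) h7) h9) h9) h9,
    mul_nonneg (mul_nonneg (mul_nonneg (mul_nonneg (mul_nonneg (mul_nonneg (h5) h5) h5) h5) h5) h9) h9]

end LawDec
end Quant
end Summit.CriticalPhenomena.PercolationContinuityZ3.Theorems
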